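import Summits.BirchSwinnertonDyer.BirchSwinnertonDyer.Theorems.Rank1ResidualX11RankOneMinimality
import HarnessLib

/-!
# Route G plumbing: the bounded Kraus–Silverman minimality criterion with an ARBITRARY trial-division
# bound `B` (`|Δ| < B¹²`) — for the A10-split targets whose minimal discriminant exceeds `512¹²`
# (cell `bsd-eis`, seat `bsd-eis-ky` gen 4; THEOREMS ONLY, nothing booked)

HONEST FRAMING (FULL-BSD rank-≤1 programme D-0033, cell `bsd-eis`; row A10-split). The route-G display files
(`X2/RouteGSplitDisplay*.lean`, generator `HOME/ky-gen/routeg_gen.py`) prove global minimality of the two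
Cremona models by the tree's `isGloballyMinimal_of_krausCriterion_bounded` (`q < 512`, `|Δ| < 512¹²`, `decide`).
Three targets of the eng-2 BOTH-HOLD list (127794bo1, 316110m1, 360789j1) have `|Δ| ≥ 512¹²`. This file is the
same corollary of `isGloballyMinimal_of_krausCriterion` (Silverman VII.1 Rem. 1.1 + Kraus 1989 at `2`, `3`)
with the bound `512` replaced by a parameter `B`: primes `q ≥ B` have `q¹² ≥ B¹² > |Δ|`, the primes `q < B`
are the `decide` obligation. References: [SilvermanAEC2009] VII.1 Remark 1.1; [Kraus1989] Prop. 1, Prop. 2.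
-/

set_option autoImplicit false

noncomputable section

open WeierstrassCurve Literature.NumberTheory.EllipticCurves
  Literature.NumberTheory.EllipticCurves.Rank1Residual.X11RankOneCertificates
  Summit.BirchSwinnertonDyer.BirchSwinnertonDyer.Rank1Residual.X11RankOne

namespace Summit.BirchSwinnertonDyer.Rank1Residual.X2.RouteGKraus

/-- **Bounded Kraus–Silverman criterion with trial-division bound `B`**: five a-invariants with `Δ ≠ 0`,
`|Δ| < B¹²`, and for every `q < B` the disjunction "`q < 2`, or `q¹² ∤ |Δ|`, or `q⁴ ∤ |c₄|`, or a Kraus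
pattern at `q = 2, 3`" give a globally minimal model; primes `q ≥ B` have `q¹² > |Δ|`. Verbatim the tree's
`isGloballyMinimal_of_krausCriterion_bounded` with `512 ↦ B`. [cite: SilvermanAEC2009, VII.1 Remark 1.1]
[cite: Kraus1989, Prop. 1 and Prop. 2] -/
theorem isGloballyMinimal_of_krausCriterion_bound (a1 a2 a3 a4 a6 : ℤ) (B : ℕ)
    (h0 : discOf [a1, a2, a3, a4, a6] ≠ 0) (hB : (discOf [a1, a2, a3, a4, a6]).natAbs < B ^ 12)
    (h : ∀ q < B, q < 2 ∨ ¬ q ^ 12 ∣ (discOf [a1, a2, a3, a4, a6]).natAbs ∨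
      ¬ q ^ 4 ∣ (c4Of [a1, a2, a3, a4, a6]).natAbs ∨
      (q = 2 ∧ ¬ (2 : ℤ) ^ 8 ∣ c4Of [a1, a2, a3, a4, a6] ∧ (2 : ℤ) ^ 7 ∣ c6Of [a1, a2, a3, a4, a6]) ∨
      (q = 2 ∧ ¬ (2 : ℤ) ^ 24 ∣ discOf [a1, a2, a3, a4, a6] ∧ (512 : ℤ) ∣ c6Of [a1, a2, a3, a4, a6] ∧
        (4 : ℤ) ∣ c6Of [a1, a2, a3, a4, a6] / 512 - 3) ∨
      (q = 3 ∧ (3 : ℤ) ^ 8 ∣ c6Of [a1, a2, a3, a4, a6] ∧ ¬ (3 : ℤ) ^ 9 ∣ c6Of [a1, a2, a3, a4, a6])) :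
    (⟨a1, a2, a3, a4, a6⟩ : WeierstrassCurve ℚ).IsGloballyMinimal := by
  refine isGloballyMinimal_of_krausCriterion a1 a2 a3 a4 a6 fun q hq ↦ ?_
  have hpos : 0 < (discOf [a1, a2, a3, a4, a6]).natAbs := Int.natAbs_pos.mpr h0
  by_cases hqB : q < B
  · rcases h q hqB with hlt | h12 | h4 | hF2a | ⟨h2, h24, h512, h43⟩ | hF3
    · exact absurd hq.two_le (by omega)
    · refine Or.inl (Or.inl fun h12' ↦ h12 ?_)
      rw [← Int.natCast_dvd]; exact_mod_cast h12'
    · refine Or.inl (Or.inr fun h4' ↦ h4 ?_)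
      rw [← Int.natCast_dvd]; exact_mod_cast h4'
    · exact Or.inr (Or.inl hF2a)
    · refine Or.inr (Or.inr (Or.inl ⟨h2, h24, c6Of [a1, a2, a3, a4, a6] / 512, ?_, h43⟩))
      exact (Int.mul_ediv_cancel' h512).symm
    · exact Or.inr (Or.inr (Or.inr hF3))
  · refine Or.inl (Or.inl fun h12 ↦ ?_)
    have h12' : q ^ 12 ∣ (discOf [a1, a2, a3, a4, a6]).natAbs := by
      rw [← Int.natCast_dvd]; exact_mod_cast h12
    have hle : q ^ 12 ≤ (discOf [a1, a2, a3, a4, a6]).natAbs := Nat.le_of_dvd hpos h12'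
    have hge : B ^ 12 ≤ q ^ 12 := Nat.pow_le_pow_left (by omega) 12
    omega

end Summit.BirchSwinnertonDyer.Rank1Residual.X2.RouteGKraus

end
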